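import Mathlib
import HarnessLib
import Literature.MathematicalPhysics.KineticTheory.HardSphereEuler
import Literature.MathematicalPhysics.KineticTheory.BackwardCluster

/-!
# Stub `stub_clusterShift` of the line `Sketch` (log-window-tagged-tail) for the crux
`RelayRaceLocality.GibbsLightCone` (stmt-AtomisticToContinuum-12501)

Registered stub of the lead prover's skeleton (`Cruxes/GibbsLightCone/Lines/Sketch.lean`): on the
good set of a hard-sphere flow `Φ`, the backward cluster (Aoki–Pulvirenti–Simonella–Tsuji 2015)
of the tagged particle `i` over the time window `(s, t]` along the orbit of `z` equals the
backward cluster over `(0, t - s]` along the orbit of `Φ_s z`.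

The proof is the time-shift covariance of the whole construction of
`Literature.MathematicalPhysics.KineticTheory.BackwardCluster` for an *arbitrary* curve `γ`
(no trajectory hypothesis): the collision times of the shifted curve `τ ↦ γ (τ + s)` in
`(0, t - s]` are the preimage under `τ ↦ τ + s` of the collision times of `γ` in `(s, t]`
(`clusterShift_collisionTimes_inter_Ioc`), so one set is finite iff the other is
(`clusterShift_finite_iff`); in the infinite case both collision windows are the junk value `∅`,
in the finite case the shifted window is the translate by `-s` of the original one
(`clusterShift_collisionWindow`); sorting commutes with the strictly monotone translation
(`StrictMonoOn.map_finsetSort`) and the events (pairs in contact) at corresponding times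
coincide, hence the collision-event lists agree (`clusterShift_collisionEvents`), and so do the
backward sweeps and the backward clusters (`clusterShift_backwardCluster`). The flow version
follows from the group property `Φ_{τ + s} = Φ_τ ∘ Φ_s` on the good set
(`HardSphereFlow.flow_add`, `HardSphereFlow.mapsTo_good`).
-/

namespace Summit.AtomisticToContinuum.HydrodynamicLimit.Theorems.LogWindowTaggedTail

open Literature.MathematicalPhysics.KineticTheory Literature.Analysis.FluidPDE MeasureTheory Filter Set

section Curve

variable {d : Type*} [Fintype d] {X : Type*} {N : ℕ} (G : Geometry d X) (ε : ℝ)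
  (γ : ℝ → Config N d X) (s t : ℝ)

/-- The collision times of the shifted curve `τ ↦ γ (τ + s)` in `(0, t - s]` are the preimage
under `τ ↦ τ + s` of the collision times of `γ` in `(s, t]`. [folklore] -/
theorem clusterShift_collisionTimes_inter_Ioc :
    collisionTimes G ε (fun τ => γ (τ + s)) ∩ Ioc 0 (t - s) =
      (fun τ => τ + s) ⁻¹' (collisionTimes G ε γ ∩ Ioc s t) := by
  ext τ
  simp only [mem_inter_iff, mem_preimage, mem_Ioc, mem_collisionTimes]
  constructor
  · rintro ⟨h, h0, h1⟩
    exact ⟨h, by linarith, by linarith⟩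
  · rintro ⟨h, h0, h1⟩
    exact ⟨h, by linarith, by linarith⟩

/-- The shifted curve has finitely many collision times in `(0, t - s]` iff `γ` has finitely
many in `(s, t]`. [folklore] -/
theorem clusterShift_finite_iff :
    (collisionTimes G ε (fun τ => γ (τ + s)) ∩ Ioc 0 (t - s)).Finite ↔
      (collisionTimes G ε γ ∩ Ioc s t).Finite := by
  rw [clusterShift_collisionTimes_inter_Ioc]
  exact ⟨fun h => h.of_preimage (add_right_surjective s),
    fun h => h.preimage (add_left_injective s).injOn⟩

/-- In the finite case, the collision window of the shifted curve over `(0, t - s]` is the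
translate by `-s` of the collision window of `γ` over `(s, t]`. [folklore] -/
theorem clusterShift_collisionWindow (hfin : (collisionTimes G ε γ ∩ Ioc s t).Finite) :
    collisionWindow G ε (fun τ => γ (τ + s)) 0 (t - s) =
      (collisionWindow G ε γ s t).map ⟨fun τ => τ - s, sub_left_injective⟩ := by
  have hfin' := (clusterShift_finite_iff G ε γ s t).2 hfin
  ext τ
  rw [mem_collisionWindow hfin', Finset.mem_map]
  constructor
  · rintro ⟨hτ, h0, h1⟩
    refine ⟨τ + s, (mem_collisionWindow hfin).2 ⟨hτ, by linarith, by linarith⟩, ?_⟩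
    simp
  · rintro ⟨σ, hσ, rfl⟩
    obtain ⟨hσc, h0, h1⟩ := (mem_collisionWindow hfin).1 hσ
    refine ⟨?_, ?_, ?_⟩
    · rw [mem_collisionTimes] at hσc ⊢
      simpa only [Function.Embedding.coeFn_mk, sub_add_cancel] using hσc
    · simp only [Function.Embedding.coeFn_mk]
      linarith
    · simp only [Function.Embedding.coeFn_mk]
      linarith

/-- The collision events of the shifted curve over `(0, t - s]` are those of `γ` over `(s, t]`
(in the infinite case both windows are the junk value `∅`). [folklore] -/
theorem clusterShift_collisionEvents :
    collisionEvents G ε (fun τ => γ (τ + s)) 0 (t - s) = collisionEvents G ε γ s t := by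
  by_cases hfin : (collisionTimes G ε γ ∩ Ioc s t).Finite
  · have hmono : StrictMonoOn (⟨fun τ => τ - s, sub_left_injective⟩ : ℝ ↪ ℝ)
        ((collisionWindow G ε γ s t : Finset ℝ) : Set ℝ) :=
      fun a _ b _ hab => sub_lt_sub_right hab s
    rw [collisionEvents, collisionEvents, clusterShift_collisionWindow G ε γ s t hfin,
      ← hmono.map_finsetSort, List.map_map]
    refine List.map_congr_left fun τ _ => ?_
    simp only [Function.comp_apply, Function.Embedding.coeFn_mk, sub_add_cancel]
  · have hfin' : ¬ (collisionTimes G ε (fun τ => γ (τ + s)) ∩ Ioc 0 (t - s)).Finite :=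
      fun h => hfin ((clusterShift_finite_iff G ε γ s t).1 h)
    rw [collisionEvents, collisionEvents, collisionWindow, dif_neg hfin', collisionWindow,
      dif_neg hfin, Finset.sort_empty, List.map_nil, List.map_nil]

/-- **Time-shift covariance of the backward cluster of a curve**: the backward cluster of `i`
along `γ` over `(s, t]` is the backward cluster of `i` along the shifted curve `τ ↦ γ (τ + s)`
over `(0, t - s]`. [folklore] -/
theorem clusterShift_backwardCluster (i : Fin N) :
    backwardCluster G ε γ i s t = backwardCluster G ε (fun τ => γ (τ + s)) i 0 (t - s) := by
  rw [backwardCluster, backwardCluster, backwardSweep, backwardSweep,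
    clusterShift_collisionEvents]

end Curve

/-- CLUSTER SHIFT (registered stub `stub_clusterShift` of the line `Sketch` for the crux
`GibbsLightCone`, stmt-AtomisticToContinuum-12501; deterministic): on the good set, the backward
cluster over the window `(s, t]` along the orbit of `z` is the backward cluster over `(0, t - s]`
along the orbit of `Φ_s z` (`HardSphereFlow.flow_add` and the time-shift covariance of
`collisionWindow` / `collisionEvents`, `clusterShift_backwardCluster`). [folklore] -/
theorem stub_clusterShift :
    ∀ (N : ℕ) (ε : ℝ) (Φ : HardSphereFlow (Torus.geometry (Fin 3)) ε N) (z : Config N (Fin 3) T3),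
    z ∈ Φ.good → ∀ (i : Fin N) (s t : ℝ),
      Φ.backwardCluster i s t z = Φ.backwardCluster i 0 (t - s) (Φ.flow s z) := by
  intro N ε Φ z hz i s t
  have hγ : (fun τ => Φ.flow τ (Φ.flow s z)) = fun τ => Φ.flow (τ + s) z :=
    funext fun τ => (Φ.flow_add τ s z hz).symm
  rw [Φ.backwardCluster_apply hz, Φ.backwardCluster_apply (Φ.mapsTo_good s hz), hγ]
  exact clusterShift_backwardCluster _ _ _ _ _ _

end Summit.AtomisticToContinuum.HydrodynamicLimit.Theorems.LogWindowTaggedTail
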